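import Literature.Computability.Complexity.CookMertzInterpolation
import HarnessLib

/-!
# The Cook–Mertz Tree Evaluation procedure `Add`: correctness as a pure function on the register file

J. Cook, I. Mertz, *Tree Evaluation Is in Space O(log n · log log n)*, STOC 2024 [CookMertz2024]
(ECCC TR23-174, held as `paper:galaxy-pdf-510431102072543260`: the register program of Lemma 14,
p. 12, and its loop invariant, p. 14); R. Williams, *Simulating Time with Square-Root Space*,
STOC 2025 [Williams2025] (arXiv:2502.17779, Appendix A "An Overview of The Cook–Mertz Procedure",
pp. 20–22 of the arXiv text: the framed recursive procedure `Add`, the interpolation formula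
(eq. interp) and the closing paragraph on low-degree extensions); O. Goldreich, ECCC TR24-109
[Goldreich2024CookMertz] (§1 "The improved (recursive) algorithm", steps 1–6, eq. (2); §2 the
low-degree digest), whose rendering Williams follows ("our description below heavily draws from
Goldreich's exposition", App. A).

## What is formalised

The CATALYTIC CORE of the procedure, as a pure function on the register file, in Williams's
characteristic-2 rendering (App. A: "our formula is slightly simpler than Cook–Mertz and Goldreich,
because we assume 𝔽 is a field of characteristic two" — the second round of recursive calls then
SUBTRACTS the children's values by ADDING them again, so no inverse programme / sign parameter `τ`
is needed), and directly in the LOW-DEGREE form of the closing paragraph of App. A (= Goldreich §2,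
Cook–Mertz Lemma 14 with a subfield in place of our symbol code): values are `n` symbols of a finite
alphabet `A`, coded into the field by an injective `e : A → F` (Williams: "a set `S ⊆ 𝔽` … put in
one-to-one correspondence with the elements of `{0,1}^{q/2}`", `t = b/log|S|` symbols per value), and
the node polynomials are the products of univariate LAGRANGE bases on `e(A)` — total degree
`≤ d·n·(|A| − 1)` (Williams: "degree `d·(|S|−1)·t`").

* `CookMertz.TETreeA A d n h` — Tree Evaluation instances of height `h`, fan-in `d`, values in
  `Fin n → A` (Williams §2 "Tree Evaluation Problem", in the padded form of App. A ¶2: every inner node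
  has exactly `d` children); `TETreeA.value` — the value of the root.
* `CookMertz.Regs F d n = (Fin d → Fin n → F) × (Fin n → F)` — the global storage
  `(x̂_1, …, x̂_d, ŷ)` of App. A: `d` children blocks and the target block, `n` field registers each.
* `CookMertz.lagr`, `CookMertz.deltaLD`, `CookMertz.ldext` — Lagrange basis, the indicator polynomial
  `δ_{a_1,…,a_d}` of a grid point and the low-degree extension `f̃_{u,j}` (App. A, eq. low-degree);
  `totalDegree_ldext_le : totalDegree ≤ d·n·(|A|−1)`, `eval_ldext : f̃_{u,j}(e ∘ w) = e (f w j)`.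
* `CookMertz.callChild`, `CookMertz.passChildren`, `CookMertz.evalInto`, `CookMertz.iteration`,
  `CookMertz.cmAddLD` — the framed procedure `Add` of App. A literally: for `i = 1, …, m`: multiply the
  children blocks by `ω^i`; for `r = 1..d` rotate block `r` into the target position and call `Add`
  on child `ur` (`callChild`: the register ROTATION is the swap `x̂_r ↔ ŷ` around the recursive
  call); add `f̃_{u,j}(ω^i x̂ + v)` to `ŷ^(j)` (`evalInto`); call `Add` on the children again (in
  characteristic 2 this removes `v_{ur}`); divide by `ω^i`. A leaf adds its value `e ∘ v_u`.
* **`CookMertz.cmAddLD_eq`** — CORRECTNESS (the "claim" in the framed pseudocode of App. A: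
  "now the storage has the form `(u, x̂_1, …, x̂_d, ŷ + f̃_u(v_{u1}, …, v_{ud}))`", with
  `f̃_u(v_{u1},…) = v_u`): whatever the initial register contents `R = (x̂, ŷ)`,
  `Add` returns `(x̂, ŷ + e ∘ value)` — over any field of characteristic 2, for any `m` with
  `(m : F) = 1`, any primitive `m`-th root of unity `ω` and any injective code with `d·n·(|A|−1) < m`.
  **`CookMertz.cookMertzAddCorrectLD`** — the printed instance `m = |F| − 1` for a finite field of
  characteristic 2 (App. A: "let `m` be such that `|𝔽| = m + 1`, and let `ω` be an `m`-th root of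
  unity"; the typed target `CookMertzAddCorrectLD` of cell pnp-ideate, seat p3, binder for binder).

The key step is the interpolation identity `Σ_{i<m} P(ω^i x̂ + v) = m · P(v)` for `totalDegree P < m`
(App. A eq. (interp); Cook–Mertz Lemma 8 = TR23-174 Lemma 12; Goldreich eq. (2)), which is the tree's
`Literature.Computability.Complexity.cookMertz_interpolation` (`CookMertzInterpolation.lean`) and
is imported, not re-proved.

## Design notes / what is NOT here

* This file is machine-free: it proves that the register-level recursion computes the right FIELD
  ELEMENTS. The space accounting (App. A: local storage `O(h · log(d·b))`, global `O(d·b)`), i.e.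
  Williams's Thm 2.2 = Cook–Mertz Thm 7 as a `DSPACE` statement, is the machine layer and is not in
  this file; nor is Williams's reduction of time-`t` computations to implicit Tree Evaluation
  instances (§3) — see the named fact `DTIME_subset_DSPACE_sqrt` (`TimeSpace.lean`, pnp.S37).
* Degree side condition. Williams (App. A, last paragraph) asks that `d·(|S|−1)·t` be "less than
  `|𝔽|`" and then applies eq. (interp), which needs degree `< m = |𝔽| − 1`; we assume the latter,
  `d·n·(|A|−1) < m`, which is what the interpolation consumes (his parameter choice
  `d(db−1)b < d²b² = |𝔽|` satisfies it as soon as `db > 1`). Cook–Mertz Lemma 14 prints the strict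
  form `a(|𝓕|−1) < |𝓚|−1` as we do.
* The multilinear version of App. A's main text (values in `{0,1}^b`, `f̃` multilinear of degree
  `d·b`, `|𝔽| ≥ db²`) is the case `A = Bool`, `e = (↑) ∘ Bool.toNat`-style `0/1` code, `n = b`:
  the Lagrange bases on `{0,1}` are `X` and `1 − X`.
* Iteration index: App. A runs `i = 1, …, m`; `cmAddLD` folds over `List.range m` with exponent
  `i + 1`, and `sum_range_shift` moves `Σ_{i<m} g(ω^{i+1})` to `Σ_{i<m} g(ω^i)` using `ω^m = 1`.

## References

* [Williams2025] R. R. Williams, *Simulating Time with Square-Root Space*, STOC 2025, 13–23,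
  Appendix A (arXiv:2502.17779 pp. 20–22); Thm 2.2 (= [CookMertz2024, Thm 7]).
* [CookMertz2024] J. Cook, I. Mertz, *Tree Evaluation Is in Space O(log n · log log n)*, STOC 2024,
  1268–1278; ECCC TR23-174 Lemma 12 (interpolation), Lemma 14 and its proof §5 p. 14 (the register
  program and its invariant).
* [Goldreich2024CookMertz] O. Goldreich, *On the Cook–Mertz Tree Evaluation procedure*, ECCC
  TR24-109 (2024), §1 (steps 1–6, eq. (2)), §2 (low-degree extensions).
-/

namespace Literature.Computability.Complexity

open MvPolynomial Finset Polynomial Function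

namespace CookMertz

/-! ### Tree Evaluation instances and the register file -/

/-- **Tree Evaluation instances** (Williams 2025 §2 "Tree Evaluation Problem", padded as in App. A
¶2 so that every inner node has exactly `d` children): a tree of height `h`, each leaf labelled
with a value — a string of `n` symbols of the alphabet `A` (`Fin n → A`; Williams: `b` bits, here
grouped into `n = t` symbols as in App. A's last paragraph) — and each inner node with a function
from the `d` children's values to a value. [cite: Williams2025, §2 and App. A] -/
inductive TETreeA (A : Type*) (d n : ℕ) : ℕ → Type _
  | leaf : (Fin n → A) → TETreeA A d n 0
  | node {k : ℕ} : ((Fin d → Fin n → A) → (Fin n → A)) → (Fin d → TETreeA A d n k) →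
      TETreeA A d n (k + 1)

namespace TETreeA

variable {A : Type*} {d n : ℕ}

/-- **The value of (the root of) a Tree Evaluation instance**: a leaf's value is its label, an inner
node's value is its function applied to the values of its `d` children (Williams 2025 App. A,
eqs. (1)–(2): `v_u = f_u(v_{u1}, …, v_{ud})`). [cite: Williams2025, App. A] -/
def value : {k : ℕ} → TETreeA A d n k → (Fin n → A)
  | _, leaf v => v
  | _, node f c => f (fun r => (c r).value)

end TETreeA

section Registers

variable {F : Type*} [Field F] {A : Type*} [Fintype A] [DecidableEq A] {d n : ℕ}

/-- The univariate **Lagrange basis polynomial** of the node `e c` on the node set `e(A) ⊆ F`, in the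
variable `p` of the grid `Fin d × Fin n`: `Π_{c' ≠ c} (e c − e c')⁻¹ · (X_p − e c')`. [folklore] -/
noncomputable def lagr (e : A → F) (c : A) (p : Fin d × Fin n) : MvPolynomial (Fin d × Fin n) F :=
  ∏ c' ∈ Finset.univ.erase c, (MvPolynomial.C (e c - e c')⁻¹ * (X p - MvPolynomial.C (e c')))

/-- **The indicator polynomial `δ_{a_1,…,a_d}` of a grid point** `a` (Williams 2025 App. A, after
eq. (low-degree): "a polynomial over 𝔽 such that `δ_{a}(a) = 1`, and `δ_{a}` vanishes on all
`a' ∈ S^t`, `a' ≠ a` … can be constructed with degree `d·(|S|−1)·t`"): the product over all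
`d·n` variables of the Lagrange bases of the symbols of `a`. [cite: Williams2025, App. A] -/
noncomputable def deltaLD (e : A → F) (a : Fin d → Fin n → A) : MvPolynomial (Fin d × Fin n) F :=
  ∏ p : Fin d × Fin n, lagr e (a p.1 p.2) p

/-- **The low-degree extension `f̃_{u,j}`** of the `j`-th output symbol of a node function `f`
(Williams 2025 App. A, eq. (low-degree): `f̃_{u,j}(x⃗_1,…,x⃗_d) = Σ_{a ∈ (S^t)^d} δ_a(x⃗) · f_{u,j}(a)`,
the symbol `f_{u,j}(a) ∈ S` read in `𝔽` through the code `e`). [cite: Williams2025, App. A] -/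
noncomputable def ldext (e : A → F) (f : (Fin d → Fin n → A) → (Fin n → A)) (j : Fin n) :
    MvPolynomial (Fin d × Fin n) F :=
  ∑ a : Fin d → Fin n → A, MvPolynomial.C (e (f a j)) * deltaLD e a

variable (F d n) in
/-- **The global storage** `(x̂_1, …, x̂_d, ŷ)` of Williams 2025 App. A: `d` children blocks and one
target block, each of `n` registers holding field elements ("each `x̂_i` is a collection of `b`
registers … holding `b` elements of 𝔽", resp. `t = b/log|S|` elements in the low-degree version).
[cite: Williams2025, App. A] -/
abbrev Regs := (Fin d → Fin n → F) × (Fin n → F)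

/-- **One recursive call on child `r` with the register rotation of App. A**: block `r` is moved into
the target position and the target block takes its place ("Rotate registers, so
`(x̂_r,…,x̂_d,ŷ,x̂'_1,…,x̂'_{r−1})` shifts to `(x̂_{r+1},…,ŷ,x̂'_1,…,x̂'_{r−1},x̂_r)`"), the child
procedure `Ad` is run, and the blocks are rotated back. [cite: Williams2025, App. A] -/
def callChild (Ad : Regs F d n → Regs F d n) (r : Fin d) (R : Regs F d n) : Regs F d n :=
  let R' := Ad (Function.update R.1 r R.2, R.1 r)
  (Function.update R'.1 r R'.2, R'.1 r)

/-- **One round of recursive calls** "For `r = 1, …, d` … call `Add` on `ur`" (Williams 2025 App. A;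
Goldreich TR24-109 §1 steps 1–2 / 4–5 for `d = 2`). [cite: Williams2025, App. A] -/
def passChildren (Ad : Fin d → Regs F d n → Regs F d n) (R : Regs F d n) : Regs F d n :=
  (List.finRange d).foldl (fun R r => callChild (Ad r) r R) R

/-- **The interpolation step** "For all `j = 1, …, b`, … Update `ŷ^(j) = ŷ^(j) + f̃_{u,j}(x̂_1, …, x̂_d)`"
evaluated at the CURRENT contents of the children blocks (Williams 2025 App. A; Goldreich §1
step 3). [cite: Williams2025, App. A] -/
noncomputable def evalInto (e : A → F) (f : (Fin d → Fin n → A) → (Fin n → A)) (R : Regs F d n) :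
    Regs F d n :=
  (R.1, fun j => R.2 j + MvPolynomial.eval (fun p : Fin d × Fin n => R.1 p.1 p.2) (ldext e f j))

/-- **Iteration `i` of the framed procedure `Add`** (Williams 2025 App. A): multiply the children
blocks by `ω^i`; call `Add` on every child (block `r` becomes `ω^i x̂_r + v_{ur}`); add
`f̃_{u,j}(ω^i x̂_1 + v_{u1}, …, ω^i x̂_d + v_{ud})` to `ŷ^(j)`; call `Add` on every child again
("note: here we use the fact that 𝔽 is characteristic two" — adding `v_{ur}` twice removes it);
divide the children blocks by `ω^i`. [cite: Williams2025, App. A] -/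
noncomputable def iteration (ω : F) (e : A → F) (f : (Fin d → Fin n → A) → (Fin n → A))
    (Ad : Fin d → Regs F d n → Regs F d n) (i : ℕ) (R : Regs F d n) : Regs F d n :=
  let R₁ : Regs F d n := (fun r j => ω ^ i * R.1 r j, R.2)
  let R₂ := passChildren Ad R₁
  let R₃ := evalInto e f R₂
  let R₄ := passChildren Ad R₃
  (fun r j => (ω ^ i)⁻¹ * R₄.1 r j, R₄.2)

/-- **The Cook–Mertz procedure `Add`** in Williams's characteristic-2 rendering with low-degree
extensions (Williams 2025 App. A, framed procedure; Cook–Mertz 2024 Lemma 14; Goldreich TR24-109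
§1–2), as a pure function on the global storage: at a leaf, "look up the value `v_u` in the input,
and return `(u, x̂_1, …, x̂_d, ŷ + v_u)`"; at an inner node, "For `i = 1, …, m`" run `iteration i`
with the recursive calls `Add(ur) = cmAddLD … (c r)`. The parameter `m` is the order of the root of
unity `ω` (printed: `|𝔽| = m + 1`). [cite: Williams2025, App. A] -/
noncomputable def cmAddLD (ω : F) (m : ℕ) (e : A → F) :
    (k : ℕ) → TETreeA A d n k → Regs F d n → Regs F d n
  | 0, .leaf v => fun R => (R.1, fun j => R.2 j + e (v j))
  | k + 1, .node f c => fun R =>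
      (List.range m).foldl (fun R i => iteration ω e f (fun r => cmAddLD ω m e k (c r)) (i + 1) R) R

end Registers

/-! ### Register bookkeeping: a procedure that "adds a constant to the target block" -/

section Book

variable {F : Type*} [Field F] {A : Type*} [Fintype A] [DecidableEq A] {d n : ℕ}

/-- The specification of `Add` on a subtree (Williams 2025 App. A: "`Add` … takes storage content
`(u, x̂_1, …, x̂_d, ŷ)` and returns the content `(u, x̂_1, …, x̂_d, ŷ + v_u)`"): the procedure `Ad`
adds the constant vector `c` to the target block and restores the children blocks, WHATEVER the
initial contents. [cite: Williams2025, App. A] -/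
def AddsConst (Ad : Regs F d n → Regs F d n) (c : Fin n → F) : Prop :=
  ∀ R : Regs F d n, Ad R = (R.1, fun j => R.2 j + c j)

/-- A rotated call of a procedure meeting the specification adds its constant to children block `r`
("which returns `(ur, x̂_{r+1}, …, ŷ, x̂'_1, …, x̂'_r)`, where `x̂'_r = ω^i · x̂_r + v_{ur}`").
[cite: Williams2025, App. A] -/
theorem callChild_eq {Ad : Regs F d n → Regs F d n} {c : Fin n → F} (hA : AddsConst Ad c)
    (r : Fin d) (x : Fin d → Fin n → F) (y : Fin n → F) :
    callChild Ad r (x, y) = (Function.update x r (fun j => x r j + c j), y) := by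
  unfold callChild
  dsimp only
  rw [hA (Function.update x r y, x r)]
  dsimp only
  rw [Function.update_idem]
  refine Prod.ext rfl ?_
  simp

/-- Folding rotated calls over a duplicate-free list of children adds each listed child's constant
to its block (App. A: the loop "For `r = 1, …, d`"). [cite: Williams2025, App. A] -/
theorem foldl_callChild_eq {Ad : Fin d → Regs F d n → Regs F d n} {Cc : Fin d → Fin n → F}
    (hA : ∀ r, AddsConst (Ad r) (Cc r)) :
    ∀ (L : List (Fin d)), L.Nodup → ∀ (x : Fin d → Fin n → F) (y : Fin n → F),
      L.foldl (fun R r => callChild (Ad r) r R) (x, y)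
        = (fun r => if r ∈ L then (fun j => x r j + Cc r j) else x r, y) := by
  intro L
  induction L with
  | nil => intro _ x y; simp
  | cons a L ih =>
      intro hnd x y
      rw [List.nodup_cons] at hnd
      rw [List.foldl_cons, callChild_eq (hA a), ih hnd.2]
      refine Prod.ext ?_ rfl
      funext r
      by_cases hra : r = a
      · subst hra
        simp [hnd.1]
      · simp [hra]

/-- **One round of recursive calls adds the children's values to the children blocks** and leaves
the target block alone (App. A: "at this point, the storage has the form
`(ud, ŷ, ω^i · x̂_1 + v_{u1}, …, ω^i · x̂_d + v_{ud})`"). [cite: Williams2025, App. A] -/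
theorem passChildren_eq {Ad : Fin d → Regs F d n → Regs F d n} {Cc : Fin d → Fin n → F}
    (hA : ∀ r, AddsConst (Ad r) (Cc r)) (x : Fin d → Fin n → F) (y : Fin n → F) :
    passChildren Ad (x, y) = (fun r j => x r j + Cc r j, y) := by
  unfold passChildren
  rw [foldl_callChild_eq hA _ (List.nodup_finRange d)]
  refine Prod.ext ?_ rfl
  funext r j
  simp [List.mem_finRange]

/-- **One iteration of `Add` in characteristic 2**: if the recursive calls meet their specification
with constants `Cc r` (the children's values), iteration `i` restores the children blocks and adds
`f̃_{u,j}(ω^i x̂ + Cc)` to `ŷ^(j)` (App. A: the second round of calls returns `x̂''_r = ω^i · x̂_r`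
"here we use the fact that 𝔽 is characteristic two", then "Divide `x̂''_r` by `ω^i`").
[cite: Williams2025, App. A] -/
theorem iteration_eq [CharP F 2] {ω : F} (hω0 : ω ≠ 0) (e : A → F)
    (f : (Fin d → Fin n → A) → (Fin n → A))
    {Ad : Fin d → Regs F d n → Regs F d n} {Cc : Fin d → Fin n → F}
    (hA : ∀ r, AddsConst (Ad r) (Cc r)) (i : ℕ) (x : Fin d → Fin n → F) (y : Fin n → F) :
    iteration ω e f Ad i (x, y)
      = (x, fun j => y j + MvPolynomial.eval
          (fun p : Fin d × Fin n => ω ^ i * x p.1 p.2 + Cc p.1 p.2) (ldext e f j)) := by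
  unfold iteration evalInto
  dsimp only
  rw [passChildren_eq hA]
  dsimp only
  rw [passChildren_eq hA]
  refine Prod.ext ?_ rfl
  funext r j
  dsimp only
  rw [add_assoc, CharTwo.add_self_eq_zero, add_zero, ← mul_assoc,
    inv_mul_cancel₀ (pow_ne_zero i hω0), one_mul]

/-- Folding a family of "add `g x i` to the target block" maps over `List.range N` adds the sum
`Σ_{i<N} g x i` (the running sum of App. A: "it suffices to perform a running sum from `i = 1` to
`m`"). [cite: Williams2025, App. A] -/
theorem foldl_range_eq {Φ : Regs F d n → ℕ → Regs F d n}
    {g : (Fin d → Fin n → F) → ℕ → Fin n → F}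
    (hΦ : ∀ i x y, Φ (x, y) i = (x, fun j => y j + g x i j)) :
    ∀ (N : ℕ) (x : Fin d → Fin n → F) (y : Fin n → F),
      (List.range N).foldl Φ (x, y) = (x, fun j => y j + ∑ i ∈ Finset.range N, g x i j) := by
  intro N
  induction N with
  | zero => intro x y; simp
  | succ N ih =>
      intro x y
      rw [List.range_succ, List.foldl_append, ih, List.foldl_cons, List.foldl_nil, hΦ]
      refine Prod.ext rfl ?_
      funext j
      dsimp only
      rw [Finset.sum_range_succ, add_assoc]

/-- Index shift `Σ_{i<m} g(ω^{i+1}) = Σ_{i<m} g(ω^i)` for `ω^m = 1` (App. A sums over `i = 1, …, m`;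
the interpolation identity over `i = 0, …, m − 1`). [folklore] -/
private theorem sum_range_shift {m : ℕ} {ω : F} (hωm : ω ^ m = 1) (g : F → F) :
    ∑ i ∈ Finset.range m, g (ω ^ (i + 1)) = ∑ i ∈ Finset.range m, g (ω ^ i) := by
  have h1 := Finset.sum_range_succ (fun i => g (ω ^ i)) m
  have h2 := Finset.sum_range_succ' (fun i => g (ω ^ i)) m
  rw [hωm] at h1
  rw [pow_zero] at h2
  exact (add_right_cancel (h1.symm.trans h2)).symm

/-! ### Low-degree extensions: degree and values on the grid -/

/-- A Lagrange basis polynomial on `|A|` nodes has total degree `≤ |A| − 1` (the per-variable factor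
of Williams's "degree `d·(|S|−1)·t`", App. A). [cite: Williams2025, App. A] -/
theorem totalDegree_lagr_le (e : A → F) (c : A) (p : Fin d × Fin n) :
    (lagr (d := d) (n := n) e c p).totalDegree ≤ Fintype.card A - 1 := by
  unfold lagr
  refine (MvPolynomial.totalDegree_finsetProd _ _).trans ?_
  calc ∑ c' ∈ Finset.univ.erase c,
        (MvPolynomial.C (e c - e c')⁻¹ * (X p - MvPolynomial.C (e c')) :
          MvPolynomial _ F).totalDegree
      ≤ ∑ c' ∈ Finset.univ.erase c, 1 := by
        refine Finset.sum_le_sum fun c' _ => ?_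
        refine (MvPolynomial.totalDegree_mul _ _).trans ?_
        rw [MvPolynomial.totalDegree_C, zero_add]
        refine (MvPolynomial.totalDegree_sub _ _).trans ?_
        rw [MvPolynomial.totalDegree_X, MvPolynomial.totalDegree_C]
        simp
    _ = Fintype.card A - 1 := by
        rw [Finset.sum_const, smul_eq_mul, mul_one, Finset.card_erase_of_mem (Finset.mem_univ c),
          Finset.card_univ]

/-- **Degree of the indicator polynomial**: `totalDegree δ_a ≤ d·n·(|A| − 1)` (Williams 2025 App. A:
"Such a polynomial `δ` can be constructed with degree `d·(|S|−1)·t`"). [cite: Williams2025, App. A] -/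
theorem totalDegree_deltaLD_le (e : A → F) (a : Fin d → Fin n → A) :
    (deltaLD (F := F) e a).totalDegree ≤ d * n * (Fintype.card A - 1) := by
  unfold deltaLD
  refine (MvPolynomial.totalDegree_finsetProd _ _).trans ?_
  calc ∑ p : Fin d × Fin n, (lagr e (a p.1 p.2) p : MvPolynomial _ F).totalDegree
      ≤ ∑ p : Fin d × Fin n, (Fintype.card A - 1) :=
        Finset.sum_le_sum fun p _ => totalDegree_lagr_le e (a p.1 p.2) p
    _ = d * n * (Fintype.card A - 1) := by
        rw [Finset.sum_const, smul_eq_mul, Finset.card_univ, Fintype.card_prod, Fintype.card_fin,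
          Fintype.card_fin]

/-- **Degree of the low-degree extension**: `totalDegree f̃_{u,j} ≤ d·n·(|A| − 1)`.
[cite: Williams2025, App. A] -/
theorem totalDegree_ldext_le (e : A → F) (f : (Fin d → Fin n → A) → (Fin n → A)) (j : Fin n) :
    (ldext (F := F) e f j).totalDegree ≤ d * n * (Fintype.card A - 1) := by
  unfold ldext
  refine (MvPolynomial.totalDegree_finsetSum _ _).trans ?_
  refine Finset.sup_le fun a _ => ?_
  refine (MvPolynomial.totalDegree_mul _ _).trans ?_
  rw [MvPolynomial.totalDegree_C, zero_add]
  exact totalDegree_deltaLD_le e a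

/-- A Lagrange basis polynomial is the indicator of its node on the (coded) grid, for an injective
code (the per-variable factor of `δ_a(a) = 1`, `δ_a(a') = 0`, App. A). [cite: Williams2025, App. A] -/
theorem eval_lagr {e : A → F} (he : Injective e) (c : A) (w : Fin d → Fin n → A)
    (p : Fin d × Fin n) :
    MvPolynomial.eval (fun p : Fin d × Fin n => e (w p.1 p.2)) (lagr e c p)
      = if c = w p.1 p.2 then 1 else 0 := by
  unfold lagr
  rw [map_prod]
  by_cases h : c = w p.1 p.2
  · rw [if_pos h]
    refine Finset.prod_eq_one fun c' hc' => ?_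
    have hne : e c - e c' ≠ 0 := by
      rw [sub_ne_zero]
      exact fun hh => (Finset.mem_erase.1 hc').1 (he hh).symm
    simp only [map_mul, MvPolynomial.eval_C, map_sub, MvPolynomial.eval_X]
    rw [← h, inv_mul_cancel₀ hne]
  · rw [if_neg h]
    refine Finset.prod_eq_zero (Finset.mem_erase.2 ⟨Ne.symm h, Finset.mem_univ _⟩) ?_
    simp

/-- **`δ_a(a) = 1` and `δ_a(a') = 0` for `a' ≠ a`** on the coded grid (Williams 2025 App. A, the
defining property of `δ_{a_1,…,a_d}`). [cite: Williams2025, App. A] -/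
theorem eval_deltaLD {e : A → F} (he : Injective e) (a w : Fin d → Fin n → A) :
    MvPolynomial.eval (fun p : Fin d × Fin n => e (w p.1 p.2)) (deltaLD e a)
      = if a = w then 1 else 0 := by
  unfold deltaLD
  rw [map_prod]
  simp_rw [eval_lagr he]
  by_cases h : a = w
  · subst h; simp
  · rw [if_neg h]
    obtain ⟨r, jj, hne⟩ : ∃ r jj, a r jj ≠ w r jj := by
      by_contra hall
      simp only [not_exists, not_not] at hall
      exact h (funext fun r => funext fun jj => hall r jj)
    exact Finset.prod_eq_zero (Finset.mem_univ (r, jj)) (if_neg hne)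

/-- **The low-degree extension extends**: on the coded grid point `e ∘ w`, `f̃_{u,j}` takes the
value `e (f w j)` (Williams 2025 App. A, eqs. (1)–(2) with (low-degree): `v_u = f̃_u(v_{u1},…,v_{ud})`).
[cite: Williams2025, App. A] -/
theorem eval_ldext {e : A → F} (he : Injective e)
    (f : (Fin d → Fin n → A) → (Fin n → A)) (j : Fin n)
    (w : Fin d → Fin n → A) (pt : Fin d × Fin n → F) (hpt : ∀ p, pt p = e (w p.1 p.2)) :
    MvPolynomial.eval pt (ldext e f j) = e (f w j) := by
  obtain rfl : pt = fun p => e (w p.1 p.2) := funext hpt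
  unfold ldext
  rw [map_sum]
  simp_rw [map_mul, MvPolynomial.eval_C, eval_deltaLD he]
  rw [Finset.sum_eq_single w]
  · simp
  · intro a _ haw; simp [haw]
  · intro h; exact absurd (Finset.mem_univ w) h

end Book

/-! ### Correctness of `Add` -/

section Correct

variable {F : Type*} [Field F] {A : Type*} [Fintype A] [DecidableEq A] {d n : ℕ}

/-- **Correctness of the Cook–Mertz procedure `Add`** (Williams 2025 App. A, the claim of the framed
pseudocode: "now the storage has the form `(u, x̂_1, …, x̂_d, ŷ + f̃_u(v_{u1}, …, v_{ud}))`" and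
"Equation (interp) ensures that the content of `ŷ` is indeed updated to be `ŷ + f̃_u(v_{u1},…,v_{ud})`,
which equals `ŷ + v_u`"; Cook–Mertz 2024, proof of Lemma 14: "After the last iteration, Lemma 12
tells us that the output registers hold the correct values, and the first `a` registers are
restored"). Over any field of characteristic 2, for any `m` with `(m : F) = 1`, any primitive
`m`-th root of unity `ω` and any injective symbol code `e` with `d·n·(|A| − 1) < m`: from ARBITRARY
initial contents `R = (x̂, ŷ)`, `Add` returns `(x̂, ŷ + e ∘ v_u)`. Proof = induction on the tree;
the inner node case is `iteration_eq` + the running sum `foldl_range_eq` + the tree's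
interpolation identity `cookMertz_interpolation` + `eval_ldext`.
-- TODO(general form): none — `m = |F| − 1` (printed) is `cookMertzAddCorrectLD` below.
[cite: Williams2025, App. A] -/
theorem cmAddLD_eq [CharP F 2] {e : A → F} (he : Injective e) {m : ℕ} {ω : F}
    (hω : IsPrimitiveRoot ω m) (hm1 : (m : F) = 1) (hdeg : d * n * (Fintype.card A - 1) < m) :
    ∀ {k : ℕ} (T : TETreeA A d n k) (R : Regs F d n),
      cmAddLD ω m e k T R = (R.1, fun j => R.2 j + e (T.value j)) := by
  have hm0 : m ≠ 0 := by
    rintro rfl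
    simp at hm1
  have hω0 : ω ≠ 0 := hω.ne_zero hm0
  intro k T
  induction T with
  | leaf v => intro R; simp only [cmAddLD, TETreeA.value]
  | node f c ih =>
      intro R
      obtain ⟨x, y⟩ := R
      have hA : ∀ r, AddsConst (cmAddLD ω m e _ (c r)) (fun j => e ((c r).value j)) :=
        fun r R => ih r R
      simp only [cmAddLD, TETreeA.value]
      rw [foldl_range_eq (g := fun x i j => MvPolynomial.eval
          (fun p : Fin d × Fin n => ω ^ (i + 1) * x p.1 p.2 + e ((c p.1).value p.2))
          (ldext e f j)) (fun i x y => iteration_eq hω0 e f hA (i + 1) x y)]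
      refine Prod.ext rfl ?_
      funext j
      dsimp only
      congr 1
      have hshift := sum_range_shift hω.pow_eq_one
        (fun u => MvPolynomial.eval
          (fun p : Fin d × Fin n => u * x p.1 p.2 + e ((c p.1).value p.2)) (ldext e f j))
      try simp only at hshift
      rw [hshift]
      have hint := cookMertz_interpolation hω (ldext e f j)
        ((totalDegree_ldext_le e f j).trans_lt hdeg) (fun p : Fin d × Fin n => x p.1 p.2)
        (fun p => e ((c p.1).value p.2))
      try simp only at hint
      rw [hint, hm1, one_mul]
      exact eval_ldext he f j (fun r => (c r).value) _ (fun p => rfl)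

/-- In a finite field of characteristic 2, `(|F| − 1 : F) = 1` (`|F|` vanishes in `F`; Cook–Mertz:
"`m^{-1} = −1`" because "`m ≡ −1 (mod p)`", and `−1 = 1` in characteristic 2 — Williams App. A's
eq. (interp) has no factor `m`). [cite: CookMertz2024, Cor. 6 (= ECCC TR23-174 Cor. 9)] -/
theorem cast_card_sub_one_eq_one (F : Type*) [Field F] [Fintype F] [CharP F 2] :
    ((Fintype.card F - 1 : ℕ) : F) = 1 := by
  rw [Nat.cast_pred Fintype.card_pos, FiniteField.cast_card_eq_zero, zero_sub, CharTwo.neg_eq]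

/-- **Correctness of `Add`, printed instance** (Williams 2025 App. A: 𝔽 of characteristic two,
"let `m` be such that `|𝔽| = m + 1`, and let `ω` be an `m`-th root of unity in 𝔽" — a PRIMITIVE
one, as in Cook–Mertz TR23-174 Prop. 7 / Lemma 12 —, low-degree extensions over an injective symbol
code with `d·n·(|A|−1) < |𝔽| − 1`): from arbitrary register contents, `Add` adds `e ∘ v_u` to the
target block and restores the children blocks. This is, binder for binder, the typed target
`CookMertzAddCorrectLD` of cell pnp-ideate (seat p3, rung R1′ of the `DTIME_subset_DSPACE_sqrt`
ladder). [cite: Williams2025, App. A] -/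
theorem cookMertzAddCorrectLD (F : Type*) [Field F] [Fintype F] [CharP F 2]
    (A : Type*) [Fintype A] [DecidableEq A] (e : A → F) (he : Injective e) (d n k : ℕ) (ω : F)
    (hω : IsPrimitiveRoot ω (Fintype.card F - 1))
    (hdeg : d * n * (Fintype.card A - 1) < Fintype.card F - 1)
    (T : TETreeA A d n k) (R : Regs F d n) :
    cmAddLD ω (Fintype.card F - 1) e k T R = (R.1, fun j => R.2 j + e (T.value j)) :=
  cmAddLD_eq he hω (cast_card_sub_one_eq_one F) hdeg T R

end Correct

end CookMertz

end Literature.Computability.Complexity
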